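import Summits.QuantumFields.YangMills.Theorems.UnitScaleTiltHalvingCompetitorMapAction
import HarnessLib

/-!
# Route `UnitScaleTilt`, crux K1 child «MinimiserStabilityRegPr» (stmt-QuantumFields-19200), registered stub `stub_halvingStep` (H) — door v3 («Stat currency»,
# ★★OWNER RULINGS №29 (B) ∕ №30 (4), LEAD-H L-7): **THE C_E ENTRY FROM STATIONARITY INSTEAD OF MINIMALITY** — the twins of ✓`HalvingDressedCriticalitySU2.
# tracePairing_of_isMinOn_dressed(_wilson)_su2` (S11) and of ✓`HalvingCompetitorMapAction.tracePairing_of_isMinOn_localChart` (FILE A §4) with the hypothesis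
# «`A` MINIMISES the action over the competitor set `T`» REPLACED by «the action is STATIONARY at `t = 0` along every line `A + t·(s•Et)` of `T`»
# (`s ∈ ker Q` real, `Et` self-adjoint traceless) — the first-order clause that the cover lift of H-SMALL (route (b7), `…HalvingSmallMembersCoverLift` ∕
# `…CoverLiftFirstVariation`) and ✓`Prop7CritEL.deriv_comp_eq_zero_of_isCritR2` deliver along the fibre curves `t ↦ Φ (A + t·δ)`

Cell `ym3-torus` (HUMAN RULING D-0037, YM ladder rung R3 — continuum SU(2) YM₃ on the torus is a RUNG, not the Clay problem); typed by the free reserve seat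
`ym-inputs-p06` (g3) of desk `pub/ym-inputs` on LEAD-H `ym-ust-19200-w5` g4's word (HOME STATUS 2026-08-28T11:28:44Z «FILE A twin … UNASSIGNED — first FREE hand»).
`--supports … --as helper`; def-free, 0 sorry, standard axioms.  NOT a claim about the stub, the crux, the rung or a mass gap.

WHY.  The registered H text reads criticality as MINIMALITY over print's regular fibre (`T3Thm1Carrier.varProblem3.IsCritical`, reading R2), and door v2
✓`HalvingStepOfPillarsRoomDoor.halvingStep_of_rows_room` hands C_E the premise `IsMinOn wilsonAction4 (regFibrePr …) U`, consumed ONLY through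
✓`HalvingHcritTransfer.hmin_of_hcrit` → ✓`HalvingCompetitorMapAction.isMinOn_re_action_of_isMinOn_wilsonAction4` → S11 (Fermat along lines).  At the ¬room members of
H-SMALL the datum is lifted to a cover member with room, where the lift is STATIONARY but not known to be MINIMAL (LEAD-H ∕ ★★OWNER RULING №29 (B); reviewer notes of
this seat 2026-08-28T11:11–11:22Z).  Door v3 therefore needs the C_E entry from stationarity; this file is that entry, with conclusions BYTE-IDENTICAL to S11's and
FILE A §4's (the `hpair` text of ✓`HalvingSitePackage.sitePackage_of_rows_L5`), so that every consumer downstream (L2′∕L2″, L3, L4) is untouched.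

WHAT IS PROVED (no definition).
* §0 `segment_mem_competitorSet` — the segment `A + t·(s•Et)`, `|t| < r`, stays in `T = {X | sa ∧ tr 0 ∧ Q X = B ∧ X ∈ S₀}` (S11's `hT` block, once).
* §1 `re_fderiv_eq_zero_of_deriv_re_line_eq_zero` — calculus: for `g : E → ℂ` complex-differentiable at `x`, `deriv (t ↦ Re g(x + tδ)) 0 = 0 ⇒ Re (fderiv ℂ g x δ) = 0`.
* §2 ★ `tracePairing_of_derivZero_dressed_su2_at` (one direction) ∕ ★ `tracePairing_of_derivZero_dressed_su2` (all directions) — abstract `S` with the gradient identity: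
  the trace pairing of `(A, W₀(A − H(D A)) + E A)` against `s•Et` vanishes as soon as `t ↦ Re S(dress(A + t·(s•Et)))` is stationary at `0` (`dress X = X − H(D X)`).
* §3 ★★ `tracePairing_of_derivZero_dressed_wilson_su2` — S11's Wilson-chart text with `hmin` replaced by
  `hstat : ∀ s, Q s = 0 → ∀ Et sa tr0, deriv (t ↦ wilsonAction4 (U (A + t·(s•Et)))) 0 = 0` (on the segment `wilsonAction4 ∘ U = Re 𝒮_η ∘ dress`, ✓`wilsonAction4_eq_re_action`).
* §4 ★★ `tracePairing_of_derivZero_localChart` — FILE A §4's text (localised competitor map `Φ`, `Tch`, `hexp`, `hoff`) with `hmin` replaced by the same `hstat` for `Φ`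
  (on `T`, `wilsonAction4 ∘ Φ − Re 𝒮_η ∘ dress` is CONSTANT, ✓`wilsonAction4_sub_re_action_eq`, so the two derivatives along the segment agree).
* §5 ★ `derivZero_lines_of_isMinOn` — minimality over `T` ⇒ `hstat` (Fermat: ✓`FlatCriticalOfMin.isLocalMin_comp_line_of_isMinOn` + `IsLocalMin.deriv_eq_zero`); so
  ✓FILE A §4 = §4 ∘ §5 (not restated — `dedup.landed`), i.e. the Stat entry is the WEAKER hypothesis (door v3 ⊇ door v2 at C_E).

HONEST SCOPE.  Exact first-order calculus on hypotheses; `S`, `W₀`, `H`, `D`, `E`, the chart `U`∕`Φ`, the competitor set and `A` are displayed letters inhabited by nothing here;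
nothing of [Balaban1985Variational] is asserted beyond the cited first-variation structure; count-neutral helper; rung R3, not T⁴∕Clay; the Yang–Mills mass gap is NOT proved.

References: T. Bałaban, *The variational problem and background fields in renormalization group method for lattice gauge theories*, Commun. Math. Phys. **102** (1985)
277–309 [Balaban1985Variational] ((5) p.278, (47) p.285, (80)–(89) pp.290–291, (99)–(100) p.293, (111) p.294, (127)–(128) p.297, (150) p.301, (157)–(158) p.302, p.300
«we will use only the fact that they are critical configurations of the functional (5)»).
-/

set_option autoImplicit false

noncomputable section

open scoped BigOperators Matrix Matrix.Norms.L2Operator Topology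
open NormedSpace Filter

namespace Summit.QuantumFields.YangMills.Theorems.HalvingDressedStationaritySU2

open Literature.MathematicalPhysics.QuantumFieldTheory.Balaban1983to89
open B6SectADomainsV1 (Domains)
open B6SectAOperatorsV1 (BondIdx QE QE_apply)
open LatticeFieldCalculus (bondAvgIter)
open Literature.MathematicalPhysics.QuantumFieldTheory.BalabanImbrieJaffe1984to88.BIJ85AxialPropagator411 (bondAvgIter_add bondAvgIter_smul)
open FlatActionGradient (wilsonAction4_eq_re_action)
open FlatCriticalOfMin (hasDerivAt_line isLocalMin_comp_line_of_isMinOn)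
open HalvingDressedCriticality (fderiv_dressed_eq_pairing differentiableAt_dressed)
open HalvingCompetitorMapAction (wilsonAction4_sub_re_action_eq)

variable {P : Params} {β' : Type*} [Fintype β']

/-! ## §0 The segment stays in the competitor set -/

/-- For `A ∈ T = {X | sa ∧ tr 0 ∧ Q X = B ∧ X ∈ S₀}`-data (`A` bondwise self-adjoint and traceless with `Q A = B`), a real `s ∈ ker Q` and a self-adjoint traceless `Et`, the
segment `A + t·(s•Et)` stays in `T` for every `t` with `A + t·(s•Et) ∈ S₀` (✓S11's `hT` block). [cite: Balaban1985Variational, (157) p.302] -/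
theorem segment_mem_competitorSet (Dm : Domains P) {S₀ : Set (PBond P 0 → Matrix (Fin 2) (Fin 2) ℂ)} {Bdat : BondIdx Dm → Matrix (Fin 2) (Fin 2) ℂ}
    {A : PBond P 0 → Matrix (Fin 2) (Fin 2) ℂ} (hAsa : ∀ b, IsSelfAdjoint (A b)) (hAtr : ∀ b, Matrix.trace (A b) = 0) (hAQ : ∀ c : BondIdx Dm, bondAvgIter (c.1.1 : ℕ) A c.1.2 = Bdat c)
    {s : PBond P 0 → ℝ} (hs : QE Dm (WithLp.toLp 2 s) = 0) {Et : Matrix (Fin 2) (Fin 2) ℂ} (hEt : IsSelfAdjoint Et) (hEttr : Matrix.trace Et = 0)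
    {r : ℝ} (hSr : ∀ t : ℝ, |t| < r → A + t • (fun b => ((s b : ℝ) : ℂ) • Et) ∈ S₀) :
    ∀ t : ℝ, |t| < r → A + t • (fun b => ((s b : ℝ) : ℂ) • Et) ∈ {X : PBond P 0 → Matrix (Fin 2) (Fin 2) ℂ | (∀ b, IsSelfAdjoint (X b)) ∧ (∀ b, Matrix.trace (X b) = 0) ∧ (∀ c : BondIdx Dm, bondAvgIter (c.1.1 : ℕ) X c.1.2 = Bdat c) ∧ X ∈ S₀} := by
  have hQs : ∀ c : BondIdx Dm, bondAvgIter (c.1.1 : ℕ) s c.1.2 = 0 := fun c => by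
    have h := congrArg (fun v : B6SectAOperatorsV1.BondIdxSpace Dm => v c) hs
    simpa [QE_apply] using h
  have hδφ : (fun b => ((s b : ℝ) : ℂ) • Et) = fun b => (LinearMap.toSpanSingleton ℝ (Matrix (Fin 2) (Fin 2) ℂ) Et) (s b) := by
    funext b
    rw [LinearMap.toSpanSingleton_apply, Complex.coe_smul]
  intro t ht
  refine ⟨fun b => ?_, fun b => ?_, fun c => ?_, hSr t ht⟩
  · show IsSelfAdjoint (A b + t • (((s b : ℝ) : ℂ) • Et))
    rw [Complex.coe_smul]
    exact (hAsa b).add (IsSelfAdjoint.smul (IsSelfAdjoint.all t) (IsSelfAdjoint.smul (IsSelfAdjoint.all (s b)) hEt))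
  · show Matrix.trace (A b + t • (((s b : ℝ) : ℂ) • Et)) = 0
    rw [Matrix.trace_add, Matrix.trace_smul, Matrix.trace_smul, hAtr b, hEttr, smul_zero, smul_zero, add_zero]
  · rw [bondAvgIter_add, bondAvgIter_smul, Pi.add_apply, Pi.smul_apply, hAQ c, hδφ,
      ChartHInv.bondAvgIter_comp_apply (LinearMap.toSpanSingleton ℝ (Matrix (Fin 2) (Fin 2) ℂ) Et) (c.1.1 : ℕ) s c.1.2, hQs c, map_zero, smul_zero, add_zero]

/-! ## §1 Calculus: stationarity along a line ⇒ the real part of the complex Fréchet derivative vanishes in that direction -/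

section Calculus

variable {E : Type*} [NormedAddCommGroup E] [NormedSpace ℂ E]

/-- If `g : E → ℂ` is complex-differentiable at `x`, the real function `t ↦ Re g(x + tδ)` has derivative `Re (fderiv ℂ g x δ)` at `0`. [folklore] -/
theorem hasDerivAt_re_line {g : E → ℂ} {x : E} (hg : DifferentiableAt ℂ g x) (δ : E) :
    HasDerivAt (fun t : ℝ => (g (x + t • δ)).re) (fderiv ℂ g x δ).re 0 := by
  have h1 : HasFDerivAt g ((fderiv ℂ g x).restrictScalars ℝ) x := hg.hasFDerivAt.restrictScalars ℝ
  have h2 : HasFDerivAt (fun X => (g X).re) (Complex.reCLM.comp ((fderiv ℂ g x).restrictScalars ℝ)) x :=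
    Complex.reCLM.hasFDerivAt.comp x h1
  have hx : x + (0 : ℝ) • δ = x := by simp
  have h3 : HasFDerivAt (fun X => (g X).re) (Complex.reCLM.comp ((fderiv ℂ g x).restrictScalars ℝ)) (x + (0 : ℝ) • δ) := by rw [hx]; exact h2
  have h4 : HasDerivAt ((fun X => (g X).re) ∘ fun t : ℝ => x + t • δ) ((Complex.reCLM.comp ((fderiv ℂ g x).restrictScalars ℝ)) δ) 0 :=
    h3.comp_hasDerivAt (0 : ℝ) (hasDerivAt_line x δ 0)
  simpa [Function.comp_def] using h4

/-- **STATIONARITY ALONG A LINE ⇒ `Re (fderiv ℂ g x δ) = 0`.** [folklore] -/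
theorem re_fderiv_eq_zero_of_deriv_re_line_eq_zero {g : E → ℂ} {x : E} (hg : DifferentiableAt ℂ g x) {δ : E}
    (h : deriv (fun t : ℝ => (g (x + t • δ)).re) 0 = 0) : (fderiv ℂ g x δ).re = 0 := by
  rw [← (hasDerivAt_re_line hg δ).deriv]
  exact h

end Calculus

/-! ## §2 The abstract dressed functional: trace pairing from stationarity -/

section Abstract

/-- ★ **ONE DIRECTION**: for the abstract action `S` with the gradient identity, if `t ↦ Re S(dress(A + t·(s•Et)))` is stationary at `0` (`dress X = X − H(D X)`), the trace
pairing of `(A, W₀(A − H(D A)) + E A)` against `s•Et` vanishes — ✓S11's `tracePairing_of_isMinOn_dressed_su2` with Fermat's step taken as the hypothesis.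
[cite: Balaban1985Variational, (80)-(89) pp.290-291, (99)-(100) p.293, (127) p.297, (157)-(158) p.302] -/
theorem tracePairing_of_derivZero_dressed_su2_at (η : ℝ) (hη : η ≠ 0) (S : (PBond P 0 → Matrix (Fin 2) (Fin 2) ℂ) → ℂ)
    (W₀ : (PBond P 0 → Matrix (Fin 2) (Fin 2) ℂ) → (PBond P 0 → Matrix (Fin 2) (Fin 2) ℂ)) (hSd : Differentiable ℂ S)
    (hgrad : ∀ A δ : PBond P 0 → Matrix (Fin 2) (Fin 2) ℂ, fderiv ℂ S A δ =
      ((η : ℂ) ^ 2 / 2) * ∑ p : Plaq P 0, Matrix.trace ((A ⟨p.src, p.μ⟩ + A ⟨p.src.shift p.μ, p.ν⟩ - A ⟨p.src.shift p.ν, p.μ⟩ - A ⟨p.src, p.ν⟩) * (δ ⟨p.src, p.μ⟩ + δ ⟨p.src.shift p.μ, p.ν⟩ - δ ⟨p.src.shift p.ν, p.μ⟩ - δ ⟨p.src, p.ν⟩)) + (η : ℂ) ^ 4 * ∑ b : PBond P 0, Matrix.trace (W₀ A b * δ b))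
    (H : (β' → Matrix (Fin 2) (Fin 2) ℂ) →ₗ[ℂ] (PBond P 0 → Matrix (Fin 2) (Fin 2) ℂ))
    (D : (PBond P 0 → Matrix (Fin 2) (Fin 2) ℂ) → (β' → Matrix (Fin 2) (Fin 2) ℂ))
    (E : (PBond P 0 → Matrix (Fin 2) (Fin 2) ℂ) → (PBond P 0 → Matrix (Fin 2) (Fin 2) ℂ))
    (hE : ∀ (Y : PBond P 0 → Matrix (Fin 2) (Fin 2) ℂ) (b : PBond P 0) (i j : Fin 2), E Y b i j = ((η : ℂ) ^ 4)⁻¹ *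
      (-(((η : ℂ) ^ 2 / 2) * ∑ p : Plaq P 0, Matrix.trace ((H (D Y) ⟨p.src, p.μ⟩ + H (D Y) ⟨p.src.shift p.μ, p.ν⟩ - H (D Y) ⟨p.src.shift p.ν, p.μ⟩ - H (D Y) ⟨p.src, p.ν⟩) *
          ((Pi.single b (Matrix.single j i (1 : ℂ)) : PBond P 0 → Matrix (Fin 2) (Fin 2) ℂ) ⟨p.src, p.μ⟩ + (Pi.single b (Matrix.single j i (1 : ℂ)) : PBond P 0 → Matrix (Fin 2) (Fin 2) ℂ) ⟨p.src.shift p.μ, p.ν⟩ -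
            (Pi.single b (Matrix.single j i (1 : ℂ)) : PBond P 0 → Matrix (Fin 2) (Fin 2) ℂ) ⟨p.src.shift p.ν, p.μ⟩ - (Pi.single b (Matrix.single j i (1 : ℂ)) : PBond P 0 → Matrix (Fin 2) (Fin 2) ℂ) ⟨p.src, p.ν⟩)))
        - ((η : ℂ) ^ 2 / 2) * ∑ p : Plaq P 0, Matrix.trace (((Y - H (D Y)) ⟨p.src, p.μ⟩ + (Y - H (D Y)) ⟨p.src.shift p.μ, p.ν⟩ - (Y - H (D Y)) ⟨p.src.shift p.ν, p.μ⟩ - (Y - H (D Y)) ⟨p.src, p.ν⟩) *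
          (H (fderiv ℂ D Y (Pi.single b (Matrix.single j i (1 : ℂ)))) ⟨p.src, p.μ⟩ + H (fderiv ℂ D Y (Pi.single b (Matrix.single j i (1 : ℂ)))) ⟨p.src.shift p.μ, p.ν⟩ -
            H (fderiv ℂ D Y (Pi.single b (Matrix.single j i (1 : ℂ)))) ⟨p.src.shift p.ν, p.μ⟩ - H (fderiv ℂ D Y (Pi.single b (Matrix.single j i (1 : ℂ)))) ⟨p.src, p.ν⟩))
        - (η : ℂ) ^ 4 * ∑ b' : PBond P 0, Matrix.trace (W₀ (Y - H (D Y)) b' * H (fderiv ℂ D Y (Pi.single b (Matrix.single j i (1 : ℂ)))) b')))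
    {A : PBond P 0 → Matrix (Fin 2) (Fin 2) ℂ} (hD : DifferentiableAt ℂ D A)
    (s : PBond P 0 → ℝ) (Et : Matrix (Fin 2) (Fin 2) ℂ)
    (hstat : deriv (fun t : ℝ => (S ((A + t • fun b => ((s b : ℝ) : ℂ) • Et) - H (D (A + t • fun b => ((s b : ℝ) : ℂ) • Et)))).re) 0 = 0) :
    (((η : ℂ) ^ 2 / 2) * ∑ p : Plaq P 0, Matrix.trace ((A ⟨p.src, p.μ⟩ + A ⟨p.src.shift p.μ, p.ν⟩ - A ⟨p.src.shift p.ν, p.μ⟩ - A ⟨p.src, p.ν⟩) * (((s ⟨p.src, p.μ⟩ : ℝ) : ℂ) • Et + ((s ⟨p.src.shift p.μ, p.ν⟩ : ℝ) : ℂ) • Et - ((s ⟨p.src.shift p.ν, p.μ⟩ : ℝ) : ℂ) • Et - ((s ⟨p.src, p.ν⟩ : ℝ) : ℂ) • Et)) +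
      (η : ℂ) ^ 4 * ∑ b : PBond P 0, Matrix.trace ((W₀ (A - H (D A)) b + E A b) * (((s b : ℝ) : ℂ) • Et))).re = 0 := by
  have hg : DifferentiableAt ℂ (fun X => S (X - H (D X))) A := differentiableAt_dressed S H D hD (hSd _)
  have key : (fderiv ℂ (fun X => S (X - H (D X))) A (fun b => ((s b : ℝ) : ℂ) • Et)).re = 0 :=
    re_fderiv_eq_zero_of_deriv_re_line_eq_zero hg hstat
  rw [fderiv_dressed_eq_pairing η hη S W₀ hSd hgrad H D E hE hD] at key
  exact key

/-- ★ **ALL DIRECTIONS** — ✓S11's abstract text `tracePairing_of_isMinOn_dressed_su2` with the minimality hypothesis REPLACED by stationarity of `t ↦ Re S(dress(A + t·(s•Et)))`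
at `0` for every real `s ∈ ker Q` and every self-adjoint traceless `Et` (the minimality-only binders `hAsa hAtr hAQ hS₀` are not needed here).
[cite: Balaban1985Variational, (80)-(89) pp.290-291, (99)-(100) p.293, (127) p.297, (157)-(158) p.302] -/
theorem tracePairing_of_derivZero_dressed_su2 (Dm : Domains P) (η : ℝ) (hη : η ≠ 0) (S : (PBond P 0 → Matrix (Fin 2) (Fin 2) ℂ) → ℂ)
    (W₀ : (PBond P 0 → Matrix (Fin 2) (Fin 2) ℂ) → (PBond P 0 → Matrix (Fin 2) (Fin 2) ℂ)) (hSd : Differentiable ℂ S)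
    (hgrad : ∀ A δ : PBond P 0 → Matrix (Fin 2) (Fin 2) ℂ, fderiv ℂ S A δ =
      ((η : ℂ) ^ 2 / 2) * ∑ p : Plaq P 0, Matrix.trace ((A ⟨p.src, p.μ⟩ + A ⟨p.src.shift p.μ, p.ν⟩ - A ⟨p.src.shift p.ν, p.μ⟩ - A ⟨p.src, p.ν⟩) * (δ ⟨p.src, p.μ⟩ + δ ⟨p.src.shift p.μ, p.ν⟩ - δ ⟨p.src.shift p.ν, p.μ⟩ - δ ⟨p.src, p.ν⟩)) + (η : ℂ) ^ 4 * ∑ b : PBond P 0, Matrix.trace (W₀ A b * δ b))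
    (H : (β' → Matrix (Fin 2) (Fin 2) ℂ) →ₗ[ℂ] (PBond P 0 → Matrix (Fin 2) (Fin 2) ℂ))
    (D : (PBond P 0 → Matrix (Fin 2) (Fin 2) ℂ) → (β' → Matrix (Fin 2) (Fin 2) ℂ))
    (E : (PBond P 0 → Matrix (Fin 2) (Fin 2) ℂ) → (PBond P 0 → Matrix (Fin 2) (Fin 2) ℂ))
    (hE : ∀ (Y : PBond P 0 → Matrix (Fin 2) (Fin 2) ℂ) (b : PBond P 0) (i j : Fin 2), E Y b i j = ((η : ℂ) ^ 4)⁻¹ *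
      (-(((η : ℂ) ^ 2 / 2) * ∑ p : Plaq P 0, Matrix.trace ((H (D Y) ⟨p.src, p.μ⟩ + H (D Y) ⟨p.src.shift p.μ, p.ν⟩ - H (D Y) ⟨p.src.shift p.ν, p.μ⟩ - H (D Y) ⟨p.src, p.ν⟩) *
          ((Pi.single b (Matrix.single j i (1 : ℂ)) : PBond P 0 → Matrix (Fin 2) (Fin 2) ℂ) ⟨p.src, p.μ⟩ + (Pi.single b (Matrix.single j i (1 : ℂ)) : PBond P 0 → Matrix (Fin 2) (Fin 2) ℂ) ⟨p.src.shift p.μ, p.ν⟩ -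
            (Pi.single b (Matrix.single j i (1 : ℂ)) : PBond P 0 → Matrix (Fin 2) (Fin 2) ℂ) ⟨p.src.shift p.ν, p.μ⟩ - (Pi.single b (Matrix.single j i (1 : ℂ)) : PBond P 0 → Matrix (Fin 2) (Fin 2) ℂ) ⟨p.src, p.ν⟩)))
        - ((η : ℂ) ^ 2 / 2) * ∑ p : Plaq P 0, Matrix.trace (((Y - H (D Y)) ⟨p.src, p.μ⟩ + (Y - H (D Y)) ⟨p.src.shift p.μ, p.ν⟩ - (Y - H (D Y)) ⟨p.src.shift p.ν, p.μ⟩ - (Y - H (D Y)) ⟨p.src, p.ν⟩) *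
          (H (fderiv ℂ D Y (Pi.single b (Matrix.single j i (1 : ℂ)))) ⟨p.src, p.μ⟩ + H (fderiv ℂ D Y (Pi.single b (Matrix.single j i (1 : ℂ)))) ⟨p.src.shift p.μ, p.ν⟩ -
            H (fderiv ℂ D Y (Pi.single b (Matrix.single j i (1 : ℂ)))) ⟨p.src.shift p.ν, p.μ⟩ - H (fderiv ℂ D Y (Pi.single b (Matrix.single j i (1 : ℂ)))) ⟨p.src, p.ν⟩))
        - (η : ℂ) ^ 4 * ∑ b' : PBond P 0, Matrix.trace (W₀ (Y - H (D Y)) b' * H (fderiv ℂ D Y (Pi.single b (Matrix.single j i (1 : ℂ)))) b')))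
    {A : PBond P 0 → Matrix (Fin 2) (Fin 2) ℂ} (hD : DifferentiableAt ℂ D A)
    (hstat : ∀ s : PBond P 0 → ℝ, QE Dm (WithLp.toLp 2 s) = 0 → ∀ Et : Matrix (Fin 2) (Fin 2) ℂ, IsSelfAdjoint Et → Matrix.trace Et = 0 →
      deriv (fun t : ℝ => (S ((A + t • fun b => ((s b : ℝ) : ℂ) • Et) - H (D (A + t • fun b => ((s b : ℝ) : ℂ) • Et)))).re) 0 = 0) :
    ∀ s : PBond P 0 → ℝ, QE Dm (WithLp.toLp 2 s) = 0 → ∀ Et : Matrix (Fin 2) (Fin 2) ℂ, IsSelfAdjoint Et → Matrix.trace Et = 0 →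
    (((η : ℂ) ^ 2 / 2) * ∑ p : Plaq P 0, Matrix.trace ((A ⟨p.src, p.μ⟩ + A ⟨p.src.shift p.μ, p.ν⟩ - A ⟨p.src.shift p.ν, p.μ⟩ - A ⟨p.src, p.ν⟩) * (((s ⟨p.src, p.μ⟩ : ℝ) : ℂ) • Et + ((s ⟨p.src.shift p.μ, p.ν⟩ : ℝ) : ℂ) • Et - ((s ⟨p.src.shift p.ν, p.μ⟩ : ℝ) : ℂ) • Et - ((s ⟨p.src, p.ν⟩ : ℝ) : ℂ) • Et)) +
      (η : ℂ) ^ 4 * ∑ b : PBond P 0, Matrix.trace ((W₀ (A - H (D A)) b + E A b) * (((s b : ℝ) : ℂ) • Et))).re = 0 :=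
  fun s hs Et hEt hEttr => tracePairing_of_derivZero_dressed_su2_at η hη S W₀ hSd hgrad H D E hE hD s Et (hstat s hs Et hEt hEttr)

end Abstract

/-! ## §3 The Wilson chart: trace pairing from stationarity of `wilsonAction4 ∘ U` along the lines of `T` -/

section Wilson

/-- ★★ **S11 FROM STATIONARITY** — ✓`tracePairing_of_isMinOn_dressed_wilson_su2`'s text (global `SU(2)`-chart `↑(U X)(b) = e^{iη(X − H(D X))(b)}` on `T`) with
`hmin : IsMinOn (wilsonAction4 ∘ U) T A` REPLACED by `hstat`: for every real `s ∈ ker Q` and self-adjoint traceless `Et`, `t ↦ wilsonAction4 (U (A + t·(s•Et)))` is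
stationary at `0`.  On the segment (inside `T` by §0) `wilsonAction4 ∘ U = Re 𝒮_η ∘ dress` (✓`wilsonAction4_eq_re_action`), so the two derivatives at `0` agree; then §2.
[cite: Balaban1985Variational, (5) p.278, (47) p.285, (111) p.294, (157)-(158) p.302] -/
theorem tracePairing_of_derivZero_dressed_wilson_su2 (Dm : Domains P) (η : ℝ) (hη : η ≠ 0)
    (W₀ : (PBond P 0 → Matrix (Fin 2) (Fin 2) ℂ) → (PBond P 0 → Matrix (Fin 2) (Fin 2) ℂ)) (hSd : Differentiable ℂ (fun A : PBond P 0 → Matrix (Fin 2) (Fin 2) ℂ => (∑ p : Plaq P 0, (1 - (2 : ℂ)⁻¹ * Matrix.trace (exp ((Complex.I * (η : ℂ)) • A ⟨p.src, p.μ⟩) * exp ((Complex.I * (η : ℂ)) • A ⟨p.src.shift p.μ, p.ν⟩) * exp (-((Complex.I * (η : ℂ)) • A ⟨p.src.shift p.ν, p.μ⟩)) * exp (-((Complex.I * (η : ℂ)) • A ⟨p.src, p.ν⟩)))))))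
    (hgrad : ∀ A δ : PBond P 0 → Matrix (Fin 2) (Fin 2) ℂ, fderiv ℂ (fun A : PBond P 0 → Matrix (Fin 2) (Fin 2) ℂ => (∑ p : Plaq P 0, (1 - (2 : ℂ)⁻¹ * Matrix.trace (exp ((Complex.I * (η : ℂ)) • A ⟨p.src, p.μ⟩) * exp ((Complex.I * (η : ℂ)) • A ⟨p.src.shift p.μ, p.ν⟩) * exp (-((Complex.I * (η : ℂ)) • A ⟨p.src.shift p.ν, p.μ⟩)) * exp (-((Complex.I * (η : ℂ)) • A ⟨p.src, p.ν⟩)))))) A δ =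
      ((η : ℂ) ^ 2 / 2) * ∑ p : Plaq P 0, Matrix.trace ((A ⟨p.src, p.μ⟩ + A ⟨p.src.shift p.μ, p.ν⟩ - A ⟨p.src.shift p.ν, p.μ⟩ - A ⟨p.src, p.ν⟩) * (δ ⟨p.src, p.μ⟩ + δ ⟨p.src.shift p.μ, p.ν⟩ - δ ⟨p.src.shift p.ν, p.μ⟩ - δ ⟨p.src, p.ν⟩)) + (η : ℂ) ^ 4 * ∑ b : PBond P 0, Matrix.trace (W₀ A b * δ b))
    (H : (β' → Matrix (Fin 2) (Fin 2) ℂ) →ₗ[ℂ] (PBond P 0 → Matrix (Fin 2) (Fin 2) ℂ))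
    (D : (PBond P 0 → Matrix (Fin 2) (Fin 2) ℂ) → (β' → Matrix (Fin 2) (Fin 2) ℂ))
    (E : (PBond P 0 → Matrix (Fin 2) (Fin 2) ℂ) → (PBond P 0 → Matrix (Fin 2) (Fin 2) ℂ))
    (hE : ∀ (Y : PBond P 0 → Matrix (Fin 2) (Fin 2) ℂ) (b : PBond P 0) (i j : Fin 2), E Y b i j = ((η : ℂ) ^ 4)⁻¹ *
      (-(((η : ℂ) ^ 2 / 2) * ∑ p : Plaq P 0, Matrix.trace ((H (D Y) ⟨p.src, p.μ⟩ + H (D Y) ⟨p.src.shift p.μ, p.ν⟩ - H (D Y) ⟨p.src.shift p.ν, p.μ⟩ - H (D Y) ⟨p.src, p.ν⟩) *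
          ((Pi.single b (Matrix.single j i (1 : ℂ)) : PBond P 0 → Matrix (Fin 2) (Fin 2) ℂ) ⟨p.src, p.μ⟩ + (Pi.single b (Matrix.single j i (1 : ℂ)) : PBond P 0 → Matrix (Fin 2) (Fin 2) ℂ) ⟨p.src.shift p.μ, p.ν⟩ -
            (Pi.single b (Matrix.single j i (1 : ℂ)) : PBond P 0 → Matrix (Fin 2) (Fin 2) ℂ) ⟨p.src.shift p.ν, p.μ⟩ - (Pi.single b (Matrix.single j i (1 : ℂ)) : PBond P 0 → Matrix (Fin 2) (Fin 2) ℂ) ⟨p.src, p.ν⟩)))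
        - ((η : ℂ) ^ 2 / 2) * ∑ p : Plaq P 0, Matrix.trace (((Y - H (D Y)) ⟨p.src, p.μ⟩ + (Y - H (D Y)) ⟨p.src.shift p.μ, p.ν⟩ - (Y - H (D Y)) ⟨p.src.shift p.ν, p.μ⟩ - (Y - H (D Y)) ⟨p.src, p.ν⟩) *
          (H (fderiv ℂ D Y (Pi.single b (Matrix.single j i (1 : ℂ)))) ⟨p.src, p.μ⟩ + H (fderiv ℂ D Y (Pi.single b (Matrix.single j i (1 : ℂ)))) ⟨p.src.shift p.μ, p.ν⟩ -
            H (fderiv ℂ D Y (Pi.single b (Matrix.single j i (1 : ℂ)))) ⟨p.src.shift p.ν, p.μ⟩ - H (fderiv ℂ D Y (Pi.single b (Matrix.single j i (1 : ℂ)))) ⟨p.src, p.ν⟩))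
        - (η : ℂ) ^ 4 * ∑ b' : PBond P 0, Matrix.trace (W₀ (Y - H (D Y)) b' * H (fderiv ℂ D Y (Pi.single b (Matrix.single j i (1 : ℂ)))) b')))
    {S₀ : Set (PBond P 0 → Matrix (Fin 2) (Fin 2) ℂ)} {Bdat : BondIdx Dm → Matrix (Fin 2) (Fin 2) ℂ}
    (U : (PBond P 0 → Matrix (Fin 2) (Fin 2) ℂ) → GaugeField P 0 (Matrix.specialUnitaryGroup (Fin 2) ℂ))
    (hΨsa : ∀ X ∈ {X : PBond P 0 → Matrix (Fin 2) (Fin 2) ℂ | (∀ b, IsSelfAdjoint (X b)) ∧ (∀ b, Matrix.trace (X b) = 0) ∧ (∀ c : BondIdx Dm, bondAvgIter (c.1.1 : ℕ) X c.1.2 = Bdat c) ∧ X ∈ S₀}, ∀ b, IsSelfAdjoint ((X - H (D X)) b))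
    (hU : ∀ X ∈ {X : PBond P 0 → Matrix (Fin 2) (Fin 2) ℂ | (∀ b, IsSelfAdjoint (X b)) ∧ (∀ b, Matrix.trace (X b) = 0) ∧ (∀ c : BondIdx Dm, bondAvgIter (c.1.1 : ℕ) X c.1.2 = Bdat c) ∧ X ∈ S₀}, ∀ b, ((U X b : Matrix.specialUnitaryGroup (Fin 2) ℂ) : Matrix (Fin 2) (Fin 2) ℂ) = exp ((Complex.I * (η : ℂ)) • (X - H (D X)) b))
    {A : PBond P 0 → Matrix (Fin 2) (Fin 2) ℂ} (hAsa : ∀ b, IsSelfAdjoint (A b)) (hAtr : ∀ b, Matrix.trace (A b) = 0) (hAQ : ∀ c : BondIdx Dm, bondAvgIter (c.1.1 : ℕ) A c.1.2 = Bdat c)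
    (hS₀ : ∀ δ : PBond P 0 → Matrix (Fin 2) (Fin 2) ℂ, ∃ r : ℝ, 0 < r ∧ ∀ t : ℝ, |t| < r → A + t • δ ∈ S₀)
    (hD : DifferentiableAt ℂ D A)
    (hstat : ∀ s : PBond P 0 → ℝ, QE Dm (WithLp.toLp 2 s) = 0 → ∀ Et : Matrix (Fin 2) (Fin 2) ℂ, IsSelfAdjoint Et → Matrix.trace Et = 0 →
      deriv (fun t : ℝ => wilsonAction4 (U (A + t • fun b => ((s b : ℝ) : ℂ) • Et))) 0 = 0) :
    ∀ s : PBond P 0 → ℝ, QE Dm (WithLp.toLp 2 s) = 0 → ∀ Et : Matrix (Fin 2) (Fin 2) ℂ, IsSelfAdjoint Et → Matrix.trace Et = 0 →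
    (((η : ℂ) ^ 2 / 2) * ∑ p : Plaq P 0, Matrix.trace ((A ⟨p.src, p.μ⟩ + A ⟨p.src.shift p.μ, p.ν⟩ - A ⟨p.src.shift p.ν, p.μ⟩ - A ⟨p.src, p.ν⟩) * (((s ⟨p.src, p.μ⟩ : ℝ) : ℂ) • Et + ((s ⟨p.src.shift p.μ, p.ν⟩ : ℝ) : ℂ) • Et - ((s ⟨p.src.shift p.ν, p.μ⟩ : ℝ) : ℂ) • Et - ((s ⟨p.src, p.ν⟩ : ℝ) : ℂ) • Et)) +
      (η : ℂ) ^ 4 * ∑ b : PBond P 0, Matrix.trace ((W₀ (A - H (D A)) b + E A b) * (((s b : ℝ) : ℂ) • Et))).re = 0 := by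
  intro s hs Et hEt hEttr
  obtain ⟨r, hr, hSr⟩ := hS₀ (fun b => ((s b : ℝ) : ℂ) • Et)
  have hT := segment_mem_competitorSet Dm hAsa hAtr hAQ hs hEt hEttr hSr
  -- on the segment the Wilson action of the charted competitor IS `Re 𝒮_η` of its dressed field
  have hEq : (fun t : ℝ => wilsonAction4 (U (A + t • fun b => ((s b : ℝ) : ℂ) • Et))) =ᶠ[𝓝 0]
      (fun t : ℝ => ((fun A : PBond P 0 → Matrix (Fin 2) (Fin 2) ℂ => (∑ p : Plaq P 0, (1 - (2 : ℂ)⁻¹ * Matrix.trace (exp ((Complex.I * (η : ℂ)) • A ⟨p.src, p.μ⟩) * exp ((Complex.I * (η : ℂ)) • A ⟨p.src.shift p.μ, p.ν⟩) * exp (-((Complex.I * (η : ℂ)) • A ⟨p.src.shift p.ν, p.μ⟩)) * exp (-((Complex.I * (η : ℂ)) • A ⟨p.src, p.ν⟩))))))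
        ((A + t • fun b => ((s b : ℝ) : ℂ) • Et) - H (D (A + t • fun b => ((s b : ℝ) : ℂ) • Et)))).re) := by
    have hball : Metric.ball (0 : ℝ) r ∈ 𝓝 (0 : ℝ) := Metric.ball_mem_nhds 0 hr
    refine Filter.eventually_of_mem hball fun t ht => ?_
    have ht' : |t| < r := by simpa [Metric.mem_ball, Real.dist_eq] using ht
    exact wilsonAction4_eq_re_action η _ (hΨsa _ (hT t ht')) (U _) (hU _ (hT t ht'))
  have h0 : deriv (fun t : ℝ => ((fun A : PBond P 0 → Matrix (Fin 2) (Fin 2) ℂ => (∑ p : Plaq P 0, (1 - (2 : ℂ)⁻¹ * Matrix.trace (exp ((Complex.I * (η : ℂ)) • A ⟨p.src, p.μ⟩) * exp ((Complex.I * (η : ℂ)) • A ⟨p.src.shift p.μ, p.ν⟩) * exp (-((Complex.I * (η : ℂ)) • A ⟨p.src.shift p.ν, p.μ⟩)) * exp (-((Complex.I * (η : ℂ)) • A ⟨p.src, p.ν⟩))))))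
        ((A + t • fun b => ((s b : ℝ) : ℂ) • Et) - H (D (A + t • fun b => ((s b : ℝ) : ℂ) • Et)))).re) 0 = 0 := by
    rw [← hEq.deriv_eq]
    exact hstat s hs Et hEt hEttr
  exact tracePairing_of_derivZero_dressed_su2_at η hη (fun A : PBond P 0 → Matrix (Fin 2) (Fin 2) ℂ => (∑ p : Plaq P 0, (1 - (2 : ℂ)⁻¹ * Matrix.trace (exp ((Complex.I * (η : ℂ)) • A ⟨p.src, p.μ⟩) * exp ((Complex.I * (η : ℂ)) • A ⟨p.src.shift p.μ, p.ν⟩) * exp (-((Complex.I * (η : ℂ)) • A ⟨p.src.shift p.ν, p.μ⟩)) * exp (-((Complex.I * (η : ℂ)) • A ⟨p.src, p.ν⟩)))))) W₀ hSd hgrad H D E hE hD s Et h0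

end Wilson

/-! ## §4 The localised competitor map: FILE A §4 from stationarity -/

section Local

/-- ★★ **FILE A §4 FROM STATIONARITY** — ✓`HalvingCompetitorMapAction.tracePairing_of_isMinOn_localChart`'s text (localised competitor map `Φ`: the chart on the sides of the
plaquettes of `Tch`, pinned to the base point off them) with `hmin : IsMinOn (wilsonAction4 ∘ Φ) T A` REPLACED by stationarity of `t ↦ wilsonAction4 (Φ (A + t·(s•Et)))` at
`0` for every real `s ∈ ker Q` and self-adjoint traceless `Et`.  On `T` the difference `wilsonAction4 ∘ Φ − Re 𝒮_η ∘ dress` is CONSTANT (✓`wilsonAction4_sub_re_action_eq`), so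
along the segment (inside `T` by §0) the two functions differ by a constant and have the same derivative at `0`; then §2.  Conclusion BYTE-IDENTICAL to FILE A §4's (the
`hpair` binder of ✓`HalvingSitePackage.sitePackage_of_rows_L5`). [cite: Balaban1985Variational, (5) p.278, (47) p.285, (111) p.294, (150) p.301, (157)-(158) p.302] -/
theorem tracePairing_of_derivZero_localChart (Dm : Domains P) (η : ℝ) (hη : η ≠ 0)
    (W₀ : (PBond P 0 → Matrix (Fin 2) (Fin 2) ℂ) → (PBond P 0 → Matrix (Fin 2) (Fin 2) ℂ)) (hSd : Differentiable ℂ (fun A : PBond P 0 → Matrix (Fin 2) (Fin 2) ℂ => (∑ p : Plaq P 0, (1 - (2 : ℂ)⁻¹ * Matrix.trace (exp ((Complex.I * (η : ℂ)) • A ⟨p.src, p.μ⟩) * exp ((Complex.I * (η : ℂ)) • A ⟨p.src.shift p.μ, p.ν⟩) * exp (-((Complex.I * (η : ℂ)) • A ⟨p.src.shift p.ν, p.μ⟩)) * exp (-((Complex.I * (η : ℂ)) • A ⟨p.src, p.ν⟩)))))))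
    (hgrad : ∀ A δ : PBond P 0 → Matrix (Fin 2) (Fin 2) ℂ, fderiv ℂ (fun A : PBond P 0 → Matrix (Fin 2) (Fin 2) ℂ => (∑ p : Plaq P 0, (1 - (2 : ℂ)⁻¹ * Matrix.trace (exp ((Complex.I * (η : ℂ)) • A ⟨p.src, p.μ⟩) * exp ((Complex.I * (η : ℂ)) • A ⟨p.src.shift p.μ, p.ν⟩) * exp (-((Complex.I * (η : ℂ)) • A ⟨p.src.shift p.ν, p.μ⟩)) * exp (-((Complex.I * (η : ℂ)) • A ⟨p.src, p.ν⟩)))))) A δ =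
      ((η : ℂ) ^ 2 / 2) * ∑ p : Plaq P 0, Matrix.trace ((A ⟨p.src, p.μ⟩ + A ⟨p.src.shift p.μ, p.ν⟩ - A ⟨p.src.shift p.ν, p.μ⟩ - A ⟨p.src, p.ν⟩) * (δ ⟨p.src, p.μ⟩ + δ ⟨p.src.shift p.μ, p.ν⟩ - δ ⟨p.src.shift p.ν, p.μ⟩ - δ ⟨p.src, p.ν⟩)) + (η : ℂ) ^ 4 * ∑ b : PBond P 0, Matrix.trace (W₀ A b * δ b))
    (H : (β' → Matrix (Fin 2) (Fin 2) ℂ) →ₗ[ℂ] (PBond P 0 → Matrix (Fin 2) (Fin 2) ℂ))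
    (D : (PBond P 0 → Matrix (Fin 2) (Fin 2) ℂ) → (β' → Matrix (Fin 2) (Fin 2) ℂ))
    (E : (PBond P 0 → Matrix (Fin 2) (Fin 2) ℂ) → (PBond P 0 → Matrix (Fin 2) (Fin 2) ℂ))
    (hE : ∀ (Y : PBond P 0 → Matrix (Fin 2) (Fin 2) ℂ) (b : PBond P 0) (i j : Fin 2), E Y b i j = ((η : ℂ) ^ 4)⁻¹ *
      (-(((η : ℂ) ^ 2 / 2) * ∑ p : Plaq P 0, Matrix.trace ((H (D Y) ⟨p.src, p.μ⟩ + H (D Y) ⟨p.src.shift p.μ, p.ν⟩ - H (D Y) ⟨p.src.shift p.ν, p.μ⟩ - H (D Y) ⟨p.src, p.ν⟩) *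
          ((Pi.single b (Matrix.single j i (1 : ℂ)) : PBond P 0 → Matrix (Fin 2) (Fin 2) ℂ) ⟨p.src, p.μ⟩ + (Pi.single b (Matrix.single j i (1 : ℂ)) : PBond P 0 → Matrix (Fin 2) (Fin 2) ℂ) ⟨p.src.shift p.μ, p.ν⟩ -
            (Pi.single b (Matrix.single j i (1 : ℂ)) : PBond P 0 → Matrix (Fin 2) (Fin 2) ℂ) ⟨p.src.shift p.ν, p.μ⟩ - (Pi.single b (Matrix.single j i (1 : ℂ)) : PBond P 0 → Matrix (Fin 2) (Fin 2) ℂ) ⟨p.src, p.ν⟩)))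
        - ((η : ℂ) ^ 2 / 2) * ∑ p : Plaq P 0, Matrix.trace (((Y - H (D Y)) ⟨p.src, p.μ⟩ + (Y - H (D Y)) ⟨p.src.shift p.μ, p.ν⟩ - (Y - H (D Y)) ⟨p.src.shift p.ν, p.μ⟩ - (Y - H (D Y)) ⟨p.src, p.ν⟩) *
          (H (fderiv ℂ D Y (Pi.single b (Matrix.single j i (1 : ℂ)))) ⟨p.src, p.μ⟩ + H (fderiv ℂ D Y (Pi.single b (Matrix.single j i (1 : ℂ)))) ⟨p.src.shift p.μ, p.ν⟩ -
            H (fderiv ℂ D Y (Pi.single b (Matrix.single j i (1 : ℂ)))) ⟨p.src.shift p.ν, p.μ⟩ - H (fderiv ℂ D Y (Pi.single b (Matrix.single j i (1 : ℂ)))) ⟨p.src, p.ν⟩))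
        - (η : ℂ) ^ 4 * ∑ b' : PBond P 0, Matrix.trace (W₀ (Y - H (D Y)) b' * H (fderiv ℂ D Y (Pi.single b (Matrix.single j i (1 : ℂ)))) b')))
    {S₀ : Set (PBond P 0 → Matrix (Fin 2) (Fin 2) ℂ)} {Bdat : BondIdx Dm → Matrix (Fin 2) (Fin 2) ℂ}
    (Tch : Plaq P 0 → Prop)
    (Φ : (PBond P 0 → Matrix (Fin 2) (Fin 2) ℂ) → GaugeField P 0 (Matrix.specialUnitaryGroup (Fin 2) ℂ))
    (hΨsa : ∀ X ∈ {X : PBond P 0 → Matrix (Fin 2) (Fin 2) ℂ | (∀ b, IsSelfAdjoint (X b)) ∧ (∀ b, Matrix.trace (X b) = 0) ∧ (∀ c : BondIdx Dm, bondAvgIter (c.1.1 : ℕ) X c.1.2 = Bdat c) ∧ X ∈ S₀}, ∀ b, IsSelfAdjoint ((X - H (D X)) b))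
    (hexp : ∀ X ∈ {X : PBond P 0 → Matrix (Fin 2) (Fin 2) ℂ | (∀ b, IsSelfAdjoint (X b)) ∧ (∀ b, Matrix.trace (X b) = 0) ∧ (∀ c : BondIdx Dm, bondAvgIter (c.1.1 : ℕ) X c.1.2 = Bdat c) ∧ X ∈ S₀}, ∀ p, Tch p →
      ((Φ X ⟨p.src, p.μ⟩ : Matrix.specialUnitaryGroup (Fin 2) ℂ) : Matrix (Fin 2) (Fin 2) ℂ) = exp ((Complex.I * (η : ℂ)) • (X - H (D X)) ⟨p.src, p.μ⟩) ∧
      ((Φ X ⟨p.src.shift p.μ, p.ν⟩ : Matrix.specialUnitaryGroup (Fin 2) ℂ) : Matrix (Fin 2) (Fin 2) ℂ) = exp ((Complex.I * (η : ℂ)) • (X - H (D X)) ⟨p.src.shift p.μ, p.ν⟩) ∧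
      ((Φ X ⟨p.src.shift p.ν, p.μ⟩ : Matrix.specialUnitaryGroup (Fin 2) ℂ) : Matrix (Fin 2) (Fin 2) ℂ) = exp ((Complex.I * (η : ℂ)) • (X - H (D X)) ⟨p.src.shift p.ν, p.μ⟩) ∧
      ((Φ X ⟨p.src, p.ν⟩ : Matrix.specialUnitaryGroup (Fin 2) ℂ) : Matrix (Fin 2) (Fin 2) ℂ) = exp ((Complex.I * (η : ℂ)) • (X - H (D X)) ⟨p.src, p.ν⟩))
    {A : PBond P 0 → Matrix (Fin 2) (Fin 2) ℂ}
    (hoff : ∀ X ∈ {X : PBond P 0 → Matrix (Fin 2) (Fin 2) ℂ | (∀ b, IsSelfAdjoint (X b)) ∧ (∀ b, Matrix.trace (X b) = 0) ∧ (∀ c : BondIdx Dm, bondAvgIter (c.1.1 : ℕ) X c.1.2 = Bdat c) ∧ X ∈ S₀}, ∀ p, ¬ Tch p →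
      (Φ X ⟨p.src, p.μ⟩ = Φ A ⟨p.src, p.μ⟩ ∧ Φ X ⟨p.src.shift p.μ, p.ν⟩ = Φ A ⟨p.src.shift p.μ, p.ν⟩ ∧ Φ X ⟨p.src.shift p.ν, p.μ⟩ = Φ A ⟨p.src.shift p.ν, p.μ⟩ ∧
        Φ X ⟨p.src, p.ν⟩ = Φ A ⟨p.src, p.ν⟩) ∧
      ((X - H (D X)) ⟨p.src, p.μ⟩ = (A - H (D A)) ⟨p.src, p.μ⟩ ∧ (X - H (D X)) ⟨p.src.shift p.μ, p.ν⟩ = (A - H (D A)) ⟨p.src.shift p.μ, p.ν⟩ ∧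
        (X - H (D X)) ⟨p.src.shift p.ν, p.μ⟩ = (A - H (D A)) ⟨p.src.shift p.ν, p.μ⟩ ∧ (X - H (D X)) ⟨p.src, p.ν⟩ = (A - H (D A)) ⟨p.src, p.ν⟩))
    (hAsa : ∀ b, IsSelfAdjoint (A b)) (hAtr : ∀ b, Matrix.trace (A b) = 0) (hAQ : ∀ c : BondIdx Dm, bondAvgIter (c.1.1 : ℕ) A c.1.2 = Bdat c) (hAS : A ∈ S₀)
    (hS₀ : ∀ δ : PBond P 0 → Matrix (Fin 2) (Fin 2) ℂ, ∃ r : ℝ, 0 < r ∧ ∀ t : ℝ, |t| < r → A + t • δ ∈ S₀)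
    (hD : DifferentiableAt ℂ D A)
    (hstat : ∀ s : PBond P 0 → ℝ, QE Dm (WithLp.toLp 2 s) = 0 → ∀ Et : Matrix (Fin 2) (Fin 2) ℂ, IsSelfAdjoint Et → Matrix.trace Et = 0 →
      deriv (fun t : ℝ => wilsonAction4 (Φ (A + t • fun b => ((s b : ℝ) : ℂ) • Et))) 0 = 0) :
    ∀ s : PBond P 0 → ℝ, QE Dm (WithLp.toLp 2 s) = 0 → ∀ Et : Matrix (Fin 2) (Fin 2) ℂ, IsSelfAdjoint Et → Matrix.trace Et = 0 →
    (((η : ℂ) ^ 2 / 2) * ∑ p : Plaq P 0, Matrix.trace ((A ⟨p.src, p.μ⟩ + A ⟨p.src.shift p.μ, p.ν⟩ - A ⟨p.src.shift p.ν, p.μ⟩ - A ⟨p.src, p.ν⟩) * (((s ⟨p.src, p.μ⟩ : ℝ) : ℂ) • Et + ((s ⟨p.src.shift p.μ, p.ν⟩ : ℝ) : ℂ) • Et - ((s ⟨p.src.shift p.ν, p.μ⟩ : ℝ) : ℂ) • Et - ((s ⟨p.src, p.ν⟩ : ℝ) : ℂ) • Et)) +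
      (η : ℂ) ^ 4 * ∑ b : PBond P 0, Matrix.trace ((W₀ (A - H (D A)) b + E A b) * (((s b : ℝ) : ℂ) • Et))).re = 0 := by
  have hAT : A ∈ {X : PBond P 0 → Matrix (Fin 2) (Fin 2) ℂ | (∀ b, IsSelfAdjoint (X b)) ∧ (∀ b, Matrix.trace (X b) = 0) ∧
      (∀ c : BondIdx Dm, bondAvgIter (c.1.1 : ℕ) X c.1.2 = Bdat c) ∧ X ∈ S₀} := ⟨hAsa, hAtr, hAQ, hAS⟩
  -- action splitting on `T`: the Wilson action of the local competitor and `Re 𝒮_η` of its dressed field differ by a constant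
  have hsplit : ∀ X ∈ {X : PBond P 0 → Matrix (Fin 2) (Fin 2) ℂ | (∀ b, IsSelfAdjoint (X b)) ∧ (∀ b, Matrix.trace (X b) = 0) ∧
      (∀ c : BondIdx Dm, bondAvgIter (c.1.1 : ℕ) X c.1.2 = Bdat c) ∧ X ∈ S₀},
      wilsonAction4 (Φ X) - ((fun A : PBond P 0 → Matrix (Fin 2) (Fin 2) ℂ => (∑ p : Plaq P 0, (1 - (2 : ℂ)⁻¹ * Matrix.trace (exp ((Complex.I * (η : ℂ)) • A ⟨p.src, p.μ⟩) * exp ((Complex.I * (η : ℂ)) • A ⟨p.src.shift p.μ, p.ν⟩) * exp (-((Complex.I * (η : ℂ)) • A ⟨p.src.shift p.ν, p.μ⟩)) * exp (-((Complex.I * (η : ℂ)) • A ⟨p.src, p.ν⟩)))))) (X - H (D X))).re =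
      wilsonAction4 (Φ A) - ((fun A : PBond P 0 → Matrix (Fin 2) (Fin 2) ℂ => (∑ p : Plaq P 0, (1 - (2 : ℂ)⁻¹ * Matrix.trace (exp ((Complex.I * (η : ℂ)) • A ⟨p.src, p.μ⟩) * exp ((Complex.I * (η : ℂ)) • A ⟨p.src.shift p.μ, p.ν⟩) * exp (-((Complex.I * (η : ℂ)) • A ⟨p.src.shift p.ν, p.μ⟩)) * exp (-((Complex.I * (η : ℂ)) • A ⟨p.src, p.ν⟩)))))) (A - H (D A))).re :=
    fun X hX => wilsonAction4_sub_re_action_eq η Tch (X - H (D X)) (A - H (D A)) (Φ X) (Φ A) (hΨsa X hX) (hΨsa A hAT)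
      (hexp X hX) (hexp A hAT) (hoff X hX)
  intro s hs Et hEt hEttr
  obtain ⟨r, hr, hSr⟩ := hS₀ (fun b => ((s b : ℝ) : ℂ) • Et)
  have hT := segment_mem_competitorSet Dm hAsa hAtr hAQ hs hEt hEttr hSr
  -- along the segment the two functions differ by the constant `C`
  set C : ℝ := wilsonAction4 (Φ A) - ((fun A : PBond P 0 → Matrix (Fin 2) (Fin 2) ℂ => (∑ p : Plaq P 0, (1 - (2 : ℂ)⁻¹ * Matrix.trace (exp ((Complex.I * (η : ℂ)) • A ⟨p.src, p.μ⟩) * exp ((Complex.I * (η : ℂ)) • A ⟨p.src.shift p.μ, p.ν⟩) * exp (-((Complex.I * (η : ℂ)) • A ⟨p.src.shift p.ν, p.μ⟩)) * exp (-((Complex.I * (η : ℂ)) • A ⟨p.src, p.ν⟩)))))) (A - H (D A))).re with hC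
  have hEq : (fun t : ℝ => wilsonAction4 (Φ (A + t • fun b => ((s b : ℝ) : ℂ) • Et))) =ᶠ[𝓝 0]
      (fun t : ℝ => ((fun A : PBond P 0 → Matrix (Fin 2) (Fin 2) ℂ => (∑ p : Plaq P 0, (1 - (2 : ℂ)⁻¹ * Matrix.trace (exp ((Complex.I * (η : ℂ)) • A ⟨p.src, p.μ⟩) * exp ((Complex.I * (η : ℂ)) • A ⟨p.src.shift p.μ, p.ν⟩) * exp (-((Complex.I * (η : ℂ)) • A ⟨p.src.shift p.ν, p.μ⟩)) * exp (-((Complex.I * (η : ℂ)) • A ⟨p.src, p.ν⟩))))))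
        ((A + t • fun b => ((s b : ℝ) : ℂ) • Et) - H (D (A + t • fun b => ((s b : ℝ) : ℂ) • Et)))).re + C) := by
    have hball : Metric.ball (0 : ℝ) r ∈ 𝓝 (0 : ℝ) := Metric.ball_mem_nhds 0 hr
    refine Filter.eventually_of_mem hball fun t ht => ?_
    have ht' : |t| < r := by simpa [Metric.mem_ball, Real.dist_eq] using ht
    have h := hsplit _ (hT t ht')
    rw [hC]
    linarith
  have h0 : deriv (fun t : ℝ => ((fun A : PBond P 0 → Matrix (Fin 2) (Fin 2) ℂ => (∑ p : Plaq P 0, (1 - (2 : ℂ)⁻¹ * Matrix.trace (exp ((Complex.I * (η : ℂ)) • A ⟨p.src, p.μ⟩) * exp ((Complex.I * (η : ℂ)) • A ⟨p.src.shift p.μ, p.ν⟩) * exp (-((Complex.I * (η : ℂ)) • A ⟨p.src.shift p.ν, p.μ⟩)) * exp (-((Complex.I * (η : ℂ)) • A ⟨p.src, p.ν⟩))))))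
        ((A + t • fun b => ((s b : ℝ) : ℂ) • Et) - H (D (A + t • fun b => ((s b : ℝ) : ℂ) • Et)))).re) 0 = 0 := by
    rw [← deriv_add_const C, ← hEq.deriv_eq]
    exact hstat s hs Et hEt hEttr
  exact tracePairing_of_derivZero_dressed_su2_at η hη (fun A : PBond P 0 → Matrix (Fin 2) (Fin 2) ℂ => (∑ p : Plaq P 0, (1 - (2 : ℂ)⁻¹ * Matrix.trace (exp ((Complex.I * (η : ℂ)) • A ⟨p.src, p.μ⟩) * exp ((Complex.I * (η : ℂ)) • A ⟨p.src.shift p.μ, p.ν⟩) * exp (-((Complex.I * (η : ℂ)) • A ⟨p.src.shift p.ν, p.μ⟩)) * exp (-((Complex.I * (η : ℂ)) • A ⟨p.src, p.ν⟩)))))) W₀ hSd hgrad H D E hE hD s Et h0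

end Local

/-! ## §5 Minimality ⇒ stationarity along the lines of `T` (door v3's entry is the weaker hypothesis) -/

section Bridge

/-- ★ **MINIMALITY OVER `T` ⇒ STATIONARITY ALONG EVERY LINE `A + t·(s•Et)` OF `T`** (Fermat: the segment lies in `T` for `|t| < r` by §0, so `t ↦ wilsonAction4 (Φ (A + t·δ))` has a
local minimum at `0`, ✓`FlatCriticalOfMin.isLocalMin_comp_line_of_isMinOn`, hence zero derivative — `IsLocalMin.deriv_eq_zero`, no differentiability needed).  Any competitor
map `Φ`.  Composed with §4 it re-derives ✓`HalvingCompetitorMapAction.tracePairing_of_isMinOn_localChart` (`tracePairing_of_derivZero_localChart … (derivZero_lines_of_isMinOn …)`).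
[cite: Balaban1985Variational, (127)-(128) p.297, (157) p.302] -/
theorem derivZero_lines_of_isMinOn (Dm : Domains P) {S₀ : Set (PBond P 0 → Matrix (Fin 2) (Fin 2) ℂ)} {Bdat : BondIdx Dm → Matrix (Fin 2) (Fin 2) ℂ}
    (Φ : (PBond P 0 → Matrix (Fin 2) (Fin 2) ℂ) → GaugeField P 0 (Matrix.specialUnitaryGroup (Fin 2) ℂ))
    {A : PBond P 0 → Matrix (Fin 2) (Fin 2) ℂ} (hAsa : ∀ b, IsSelfAdjoint (A b)) (hAtr : ∀ b, Matrix.trace (A b) = 0) (hAQ : ∀ c : BondIdx Dm, bondAvgIter (c.1.1 : ℕ) A c.1.2 = Bdat c)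
    (hS₀ : ∀ δ : PBond P 0 → Matrix (Fin 2) (Fin 2) ℂ, ∃ r : ℝ, 0 < r ∧ ∀ t : ℝ, |t| < r → A + t • δ ∈ S₀)
    (hmin : IsMinOn (fun X => wilsonAction4 (Φ X)) {X : PBond P 0 → Matrix (Fin 2) (Fin 2) ℂ | (∀ b, IsSelfAdjoint (X b)) ∧ (∀ b, Matrix.trace (X b) = 0) ∧ (∀ c : BondIdx Dm, bondAvgIter (c.1.1 : ℕ) X c.1.2 = Bdat c) ∧ X ∈ S₀} A) :
    ∀ s : PBond P 0 → ℝ, QE Dm (WithLp.toLp 2 s) = 0 → ∀ Et : Matrix (Fin 2) (Fin 2) ℂ, IsSelfAdjoint Et → Matrix.trace Et = 0 →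
      deriv (fun t : ℝ => wilsonAction4 (Φ (A + t • fun b => ((s b : ℝ) : ℂ) • Et))) 0 = 0 := by
  intro s hs Et hEt hEttr
  obtain ⟨r, hr, hSr⟩ := hS₀ (fun b => ((s b : ℝ) : ℂ) • Et)
  have hT := segment_mem_competitorSet Dm hAsa hAtr hAQ hs hEt hEttr hSr
  exact (isLocalMin_comp_line_of_isMinOn (f := fun X => wilsonAction4 (Φ X)) hr hT hmin).deriv_eq_zero

end Bridge

end Summit.QuantumFields.YangMills.Theorems.HalvingDressedStationaritySU2

end
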